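import Summits.ResolutionOfSingularities.ResolutionOfSingularities.Theorems.FrobeniusClosingSteerBetaNewtonSupport
import Literature.AlgebraicGeometry.Resolution.CharPolyhedronOriginChart
import HarnessLib

/-!
# Crux `Steer` (stmt-ResolutionOfSingularities-16345), chain W4.1, β-LEAF, K-β2♭ part (II), file 2: TRANSPORT of the
# minimal exponent set `𝐒(f)` along the `y`-chart letter, and the VERTEX TRANSPORT lemma (def-free)

OURS (campaign `res-hironaka`, rung L ★L-G4, slot W4.1; statements about the route's own objects; they replace the
role of no printed item and are NOT statements of the manuscript under review [claim: Hironaka2017, status: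
under-review]; AI review is weaker than expert review). Seat res-D-pv-003 (gen 7), K-β2♭ kernel owner.

Along the `y`-chart substitution `φ x = φ y · x₁`, `φ z = φ y · z₁`, `φ w = φ y · w₁` the map `φ` is a MONOMIAL substitution
`φ (t^a) = t'^{L₀ a}`, `L₀ a = (a₀, |a|, a₂, a₃)`, for `t = (x, y, z, w)`, `t' = (x₁, φ y, z₁, w₁)`, so Cossart–Piltant's
Prop. 2.6 mechanism (tree `CossartPiltant.minExponents_of_mul_pow_eq`, the origin chart of a blow-up) computes the minimal
exponent set of the strict transform `g = φ f / (φ y)^d`: `𝐒(g)` is the set of minimal elements of `L₀(𝐒(f)) − d·e₁`.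

* `yChart_hrel`, `reflects_span_of_local`, `transport_apply` — bookkeeping (`L a := L₀ a − d e₁ = (a₀, |a| − d, a₂, a₃)`).
* `minExponents_strictTransform` — (1) every `a' ∈ 𝐒(g)` is `L a` for some `a ∈ 𝐒(f)`; (2) every `L a`, `a ∈ 𝐒(f)`, lies
  above some `a' ∈ 𝐒(g)` (`f ∈ 𝔪^d`, `g · (φ y)^d = φ f`).
* `vertex_transport_arith` — the arithmetic heart: if `a = (αm, βm, i, j)` is a VERTEX exponent (`BetaGe ∧ ¬BetaGt` at `a`),
  `a''` satisfies the `BetaGe (α, β)` condition, `L a'' ≤ L a` and `|L a''| ≥ d`, then `a'' = a`.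
* `two_mul_add_ge_two` — `f₁ ∈ 𝔪₁^d` forces `2α + β ≥ 2` at a vertex; `add_ge_one` — `f ∈ 𝔪^d` forces `α + β ≥ 1`.
* **`transport_vertex_mem_minExponents`** — the vertex exponent `(αm, (α+β−1)m, i, j)` of the strict transform IS a minimal
  exponent of `g` whenever `(αm, βm, i, j) ∈ 𝐒(f)`.

[cite: CossartPiltant2019, Prop. 2.6] [cite: CossartJannsenSaito2020, Lemma 12.2] No Theses file is imported; nothing here is a
route item or a registration.
-/

noncomputable section

-- `Summit.<S>.<S>.…` duplicates the summit name by design (single-problem summit).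
set_option linter.dupNamespace false

namespace Summit.ResolutionOfSingularities.ResolutionOfSingularities.Theorems.SwitchingDichotomy.BetaNewton

open IsLocalRing
open Literature.AlgebraicGeometry.Resolution
open Literature.AlgebraicGeometry.Resolution.CossartPiltant (uPow uPow_mem_span_uPow uPow_mem_span_uPow_of_le minExponents
  minExponents_of_mul_pow_eq)
open Summit.ResolutionOfSingularities.ResolutionOfSingularities.Theorems.SwitchingDichotomy.BetaPolygon
open Summit.ResolutionOfSingularities.ResolutionOfSingularities.Theorems.SwitchingDichotomy.BetaLetter (range_four)

variable {S S₁ : Type} [CommRing S] [CommRing S₁]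

/-! ## §1 Bookkeeping of the `y`-chart monomial substitution -/

/-- The `y`-chart substitution in Cossart–Piltant's origin-chart form (`j₀ = 1`, `J = univ`). [folklore] -/
theorem yChart_hrel (φ : S →+* S₁) {x y z w : S} {x₁ z₁ w₁ : S₁} (hx : φ x = φ y * x₁) (hz : φ z = φ y * z₁)
    (hw : φ w = φ y * w₁) (j : Fin 4) :
    φ (![x, y, z, w] j) = if j ∈ (Finset.univ : Finset (Fin 4)) ∧ j ≠ 1
      then ![x₁, φ y, z₁, w₁] 1 * ![x₁, φ y, z₁, w₁] j else ![x₁, φ y, z₁, w₁] j := by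
  fin_cases j <;> simp [hx, hz, hw]

/-- A ring map between local rings whose parameter ideals are the maximal ideals REFLECTS `(t')` into `(t)` (units go to
units). [folklore] -/
theorem reflects_span_of_local [IsLocalRing S] [IsLocalRing S₁] (φ : S →+* S₁) {x y z w : S} {x₁ y' z₁ w₁ : S₁}
    (hspan : Ideal.span {x, y, z, w} = maximalIdeal S) (hspan₁ : Ideal.span {x₁, y', z₁, w₁} = maximalIdeal S₁)
    (γ : S) (hγ : φ γ ∈ Ideal.span (Set.range ![x₁, y', z₁, w₁])) : γ ∈ Ideal.span (Set.range ![x, y, z, w]) := by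
  rw [range_four, hspan₁] at hγ
  rw [range_four, hspan]
  by_contra h
  have hu : IsUnit γ := by
    by_contra hnu
    exact h ((IsLocalRing.mem_maximalIdeal γ).mpr hnu)
  exact (IsLocalRing.mem_maximalIdeal _).mp hγ (hu.map φ)

/-- Coordinates of the transported exponent `L a = L₀ a − d e₁ = (a₀, |a| − d, a₂, a₃)`. [folklore] -/
theorem transport_apply (a : Fin 4 → ℕ) (d : ℕ) :
    (Function.update a 1 (∑ j ∈ (Finset.univ : Finset (Fin 4)), a j) - d • (Pi.single 1 1 : Fin 4 → ℕ)) 0 = a 0 ∧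
    (Function.update a 1 (∑ j ∈ (Finset.univ : Finset (Fin 4)), a j) - d • (Pi.single 1 1 : Fin 4 → ℕ)) 1 =
      a 0 + a 1 + a 2 + a 3 - d ∧
    (Function.update a 1 (∑ j ∈ (Finset.univ : Finset (Fin 4)), a j) - d • (Pi.single 1 1 : Fin 4 → ℕ)) 2 = a 2 ∧
    (Function.update a 1 (∑ j ∈ (Finset.univ : Finset (Fin 4)), a j) - d • (Pi.single 1 1 : Fin 4 → ℕ)) 3 = a 3 := by
  simp [Fin.sum_univ_four]


/-- Comparing an exponent with a transported exponent, coordinatewise. [folklore] -/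
theorem le_transport_iff (a a' : Fin 4 → ℕ) (d : ℕ) :
    a' ≤ Function.update a 1 (∑ j ∈ (Finset.univ : Finset (Fin 4)), a j) - d • (Pi.single 1 1 : Fin 4 → ℕ) ↔
      a' 0 ≤ a 0 ∧ a' 1 ≤ a 0 + a 1 + a 2 + a 3 - d ∧ a' 2 ≤ a 2 ∧ a' 3 ≤ a 3 := by
  obtain ⟨e0, e1, e2, e3⟩ := transport_apply a d
  constructor
  · intro h
    exact ⟨(h 0).trans e0.le, (h 1).trans e1.le, (h 2).trans e2.le, (h 3).trans e3.le⟩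
  · rintro ⟨h0, h1, h2, h3⟩ l
    fin_cases l
    · exact h0.trans e0.ge
    · exact h1.trans e1.ge
    · exact h2.trans e2.ge
    · exact h3.trans e3.ge

/-- Total degree of a transported exponent. [folklore] -/
theorem sum_transport (a : Fin 4 → ℕ) (d : ℕ) :
    ∑ l, (Function.update a 1 (∑ j ∈ (Finset.univ : Finset (Fin 4)), a j) - d • (Pi.single 1 1 : Fin 4 → ℕ)) l =
      a 0 + (a 0 + a 1 + a 2 + a 3 - d) + a 2 + a 3 := by
  obtain ⟨e0, e1, e2, e3⟩ := transport_apply a d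
  rw [sum_four, e0, e1, e2, e3]

/-! ## §2 `𝐒` of the strict transform -/

/-- **Cossart–Piltant Prop. 2.6 along the `y`-chart letter**: for `f ∈ 𝔪^d` and `g · (φ y)^d = φ f`, (1) every minimal
exponent of `g` is `L a = (a₀, |a| − d, a₂, a₃)` for some `a ∈ 𝐒(f)`, and (2) every `L a`, `a ∈ 𝐒(f)`, lies above a minimal
exponent of `g`. [cite: CossartPiltant2019, Prop. 2.6] -/
theorem minExponents_strictTransform [IsLocalRing S] [IsLocalRing S₁] (φ : S →+* S₁) {x y z w : S}
    {x₁ z₁ w₁ : S₁} (ht : IsRsopPart ![x, y, z, w]) (ht' : IsRsopPart ![x₁, φ y, z₁, w₁])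
    (hspan : Ideal.span {x, y, z, w} = maximalIdeal S) (hspan₁ : Ideal.span {x₁, φ y, z₁, w₁} = maximalIdeal S₁)
    (hx : φ x = φ y * x₁) (hz : φ z = φ y * z₁) (hw : φ w = φ y * w₁) {d : ℕ} {f : S} {g : S₁}
    (hfd : f ∈ maximalIdeal S ^ d) (hg : g * φ y ^ d = φ f) :
    (∀ a' ∈ minExponents ![x₁, φ y, z₁, w₁] g, ∃ a ∈ minExponents ![x, y, z, w] f,
        a' = Function.update a 1 (∑ j ∈ (Finset.univ : Finset (Fin 4)), a j) - d • (Pi.single 1 1 : Fin 4 → ℕ)) ∧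
      (∀ a ∈ minExponents ![x, y, z, w] f, ∃ a' ∈ minExponents ![x₁, φ y, z₁, w₁] g,
        a' ≤ Function.update a 1 (∑ j ∈ (Finset.univ : Finset (Fin 4)), a j) - d • (Pi.single 1 1 : Fin 4 → ℕ)) := by
  haveI := ht.isRegularLocalRing
  haveI := ht'.isRegularLocalRing
  haveI : IsDomain S₁ := isDomain_of_isRegularLocalRing S₁
  have hnzd : ∀ y₀ : S₁, ![x₁, φ y, z₁, w₁] 1 * y₀ = 0 → y₀ = 0 := fun y₀ hy₀ =>
    (mul_eq_zero.mp hy₀).resolve_left (ht'.ne_zero 1)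
  have hfi : ∀ a ∈ minExponents ![x, y, z, w] f, d ≤ ∑ j ∈ (Finset.univ : Finset (Fin 4)), a j :=
    (mem_pow_iff_forall_minExponents ht hspan d f).mp hfd
  have hg' : g * ![x₁, φ y, z₁, w₁] 1 ^ d = φ f := by simpa using hg
  exact minExponents_of_mul_pow_eq φ ![x, y, z, w] ![x₁, φ y, z₁, w₁] ht.mem_span_image_of_mul_mem ht.mem_maximalIdeal
    ht'.mem_span_image_of_mul_mem (Finset.mem_univ (1 : Fin 4)) hnzd (yChart_hrel φ hx hz hw)
    (reflects_span_of_local φ hspan hspan₁) hfi hg'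

/-! ## §3 The vertex transport -/

/-- **Arithmetic heart of the vertex transport.** Let `a = (αm, βm, i, j)` be the vertex exponent of its slot
(`m = d − i − j ≥ 1`, `α ≥ 0`), let `a''` satisfy the `BetaGe (α, β)` exponent condition, and suppose
`L a'' ≤ L a` coordinatewise (`a''₀ ≤ a₀`, `|a''| ≤ |a|`, `a''₂ ≤ a₂`, `a''₃ ≤ a₃`) with `|L a''| ≥ d` (the transported exponent
has total degree `≥ d`, i.e. `2a''₀ + a''₁ + 2(a''₂ + a''₃) ≥ 2d`). Then `a'' = a`. (The degenerate vertices `2α + β < 2` are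
exactly excluded by the degree hypothesis.) [folklore] -/
theorem vertex_transport_arith {d : ℕ} {α β : ℚ} (hα : 0 ≤ α) {a a'' : Fin 4 → ℕ}
    (hzw : a 2 + a 3 < d) (ha0 : (a 0 : ℚ) = α * ((d - a 2 - a 3 : ℕ) : ℚ))
    (ha1 : (a 1 : ℚ) = β * ((d - a 2 - a 3 : ℕ) : ℚ))
    (hG : d ≤ a'' 2 + a'' 3 ∨ ⌊α * ((d - a'' 2 - a'' 3 : ℕ) : ℚ)⌋₊ + 1 ≤ a'' 0 ∨
      (⌈α * ((d - a'' 2 - a'' 3 : ℕ) : ℚ)⌉₊ ≤ a'' 0 ∧ ⌈β * ((d - a'' 2 - a'' 3 : ℕ) : ℚ)⌉₊ ≤ a'' 1))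
    (h0 : a'' 0 ≤ a 0) (hs : a'' 0 + a'' 1 + a'' 2 + a'' 3 ≤ a 0 + a 1 + a 2 + a 3) (h2 : a'' 2 ≤ a 2)
    (h3 : a'' 3 ≤ a 3) (hdeg : 2 * d ≤ 2 * a'' 0 + a'' 1 + 2 * (a'' 2 + a'' 3)) : a'' = a := by
  -- the slots
  set m : ℕ := d - a 2 - a 3 with hm
  set m'' : ℕ := d - a'' 2 - a'' 3 with hm''
  have hm1 : 1 ≤ m := by omega
  have hmm : m ≤ m'' := by omega
  have hzw'' : a'' 2 + a'' 3 < d := by omega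
  have hmQ : (1 : ℚ) ≤ m := by exact_mod_cast hm1
  have hmmQ : (m : ℚ) ≤ m'' := by exact_mod_cast hmm
  have hαm : α * (m : ℚ) ≤ α * (m'' : ℚ) := mul_le_mul_of_nonneg_left hmmQ hα
  -- the `BetaGe` condition at `a''` is the third disjunct
  have hG3 : ⌈α * (m'' : ℚ)⌉₊ ≤ a'' 0 ∧ ⌈β * (m'' : ℚ)⌉₊ ≤ a'' 1 := by
    rcases hG with hG | hG | hG
    · exact absurd hG (by omega)
    · exfalso
      have h1 : α * (m'' : ℚ) < a'' 0 := Nat.lt_of_floor_lt hG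
      have h2 : (a'' 0 : ℚ) ≤ a 0 := by exact_mod_cast h0
      linarith
    · exact hG
  obtain ⟨hG0, hG1⟩ := hG3
  have hA0 : α * (m'' : ℚ) ≤ a'' 0 := Nat.ceil_le.mp hG0
  have hB1 : β * (m'' : ℚ) ≤ a'' 1 := Nat.ceil_le.mp hG1
  have h0Q : (a'' 0 : ℚ) ≤ a 0 := by exact_mod_cast h0
  -- `a''₀ = a₀` and `α m'' = α m`
  have he0Q : (a'' 0 : ℚ) = a 0 := le_antisymm h0Q (by linarith)
  have he0 : a'' 0 = a 0 := by exact_mod_cast he0Q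
  have hαeq : α * (m'' : ℚ) = α * (m : ℚ) := le_antisymm (by linarith) hαm
  -- the sum inequality in slot form: `a''₁ + (m'' − m)`-bookkeeping
  have hsQ : (a'' 1 : ℚ) ≤ a 1 + (m'' : ℚ) - m := by
    have : a'' 1 + m ≤ a 1 + m'' := by omega
    have : (a'' 1 : ℚ) + m ≤ a 1 + m'' := by exact_mod_cast this
    linarith
  -- the degree hypothesis in slot form: `a''₁ ≥ 2 m'' − 2 a''₀`
  have hdegQ : 2 * (m'' : ℚ) - 2 * (a'' 0 : ℚ) ≤ a'' 1 := by
    have : 2 * m'' ≤ 2 * a'' 0 + a'' 1 := by omega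
    have : 2 * (m'' : ℚ) ≤ 2 * (a'' 0 : ℚ) + a'' 1 := by exact_mod_cast this
    linarith
  -- the slots agree
  have hmeq : m'' = m := by
    rcases eq_or_lt_of_le hα with hα0 | hαpos
    · -- `α = 0`: `a₀ = 0`, `β ≥ 2`, then `(β − 1)(m'' − m) ≤ 0`
      have ha00 : (a 0 : ℚ) = 0 := by rw [ha0, ← hα0, zero_mul]
      have hβ2 : 2 * (m : ℚ) ≤ β * m := by linarith
      have hβge : (2 : ℚ) ≤ β := le_of_mul_le_mul_right (by linarith) (by linarith : (0 : ℚ) < m)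
      have hkey : β * ((m'' : ℚ) - m) ≤ (m'' : ℚ) - m := by rw [mul_sub]; linarith
      have hprod : 0 ≤ (β - 2) * ((m'' : ℚ) - m) := mul_nonneg (by linarith) (by linarith)
      have hle : (m'' : ℚ) - m ≤ 0 := by nlinarith
      have : (m'' : ℚ) ≤ m := by linarith
      exact le_antisymm (by exact_mod_cast this) hmm
    · have : (m'' : ℚ) = m := mul_left_cancel₀ (ne_of_gt hαpos) hαeq
      exact_mod_cast this
  have he2 : a'' 2 = a 2 := by omega
  have he3 : a'' 3 = a 3 := by omega
  -- `a''₁ = a₁`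
  have he1 : a'' 1 = a 1 := by
    have hle : a'' 1 ≤ a 1 := by omega
    have hge : a 1 ≤ a'' 1 := by
      have h1 : ⌈β * (m : ℚ)⌉₊ = a 1 := by rw [← ha1, Nat.ceil_natCast]
      rw [← h1, ← hmeq]
      exact hG1
    exact le_antisymm hle hge
  funext l
  fin_cases l
  · exact he0
  · exact he1
  · exact he2
  · exact he3

/-- **`α + β ≥ 1` at a vertex of an `f ∈ 𝔪^d`**: the vertex exponent `(αm, βm, i, j)` has total degree `≥ d`. [folklore] -/
theorem add_ge_one_of_vertex {d : ℕ} {α β : ℚ} {a : Fin 4 → ℕ} (hzw : a 2 + a 3 < d)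
    (ha0 : (a 0 : ℚ) = α * ((d - a 2 - a 3 : ℕ) : ℚ)) (ha1 : (a 1 : ℚ) = β * ((d - a 2 - a 3 : ℕ) : ℚ))
    (hdeg : d ≤ a 0 + a 1 + a 2 + a 3) : 1 ≤ α + β := by
  set m : ℕ := d - a 2 - a 3 with hm
  have hm1 : (1 : ℚ) ≤ m := by exact_mod_cast (show 1 ≤ m by omega)
  have h : (m : ℚ) ≤ a 0 + a 1 := by
    have : m ≤ a 0 + a 1 := by omega
    exact_mod_cast this
  rw [ha0, ha1, ← add_mul] at h
  exact le_of_mul_le_mul_right (by linarith) (by linarith : (0 : ℚ) < m)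

/-- **`2α + β ≥ 2` at a vertex whose transported exponent dominates an exponent of total degree `≥ d`** (the strict transform
lies in `𝔪₁^d`). [folklore] -/
theorem two_mul_add_ge_two_of_vertex {d : ℕ} {α β : ℚ} {a a' : Fin 4 → ℕ} (hzw : a 2 + a 3 < d)
    (ha0 : (a 0 : ℚ) = α * ((d - a 2 - a 3 : ℕ) : ℚ)) (ha1 : (a 1 : ℚ) = β * ((d - a 2 - a 3 : ℕ) : ℚ))
    (hdeg : d ≤ a 0 + a 1 + a 2 + a 3)
    (hle : a' ≤ Function.update a 1 (∑ j ∈ (Finset.univ : Finset (Fin 4)), a j) - d • (Pi.single 1 1 : Fin 4 → ℕ))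
    (hdeg' : d ≤ ∑ l, a' l) : 2 ≤ 2 * α + β := by
  obtain ⟨h0, h1, h2, h3⟩ := (le_transport_iff a a' d).mp hle
  rw [sum_four] at hdeg'
  set m : ℕ := d - a 2 - a 3 with hm
  have hm1 : (1 : ℚ) ≤ m := by exact_mod_cast (show 1 ≤ m by omega)
  have hkeyQ : 2 * (m : ℚ) ≤ 2 * a 0 + a 1 := by
    have : 2 * m ≤ 2 * a 0 + a 1 := by omega
    exact_mod_cast this
  rw [ha0, ha1] at hkeyQ
  have : 2 * (m : ℚ) ≤ (2 * α + β) * m := by linarith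
  exact le_of_mul_le_mul_right (by linarith) (by linarith : (0 : ℚ) < m)

/-- **VERTEX TRANSPORT.** In the `y`-chart transport (`minExponents_strictTransform`), let `a⋆ = (αm, βm, i, j) ∈ 𝐒(f)` be a
vertex exponent (`α, β ≥ 0`, `i + j < d`), let every `a ∈ 𝐒(f)` satisfy the `BetaGe (α, β)` condition and have `|a| ≥ d`, and
let every minimal exponent of the strict transform `g` have total degree `≥ d`. Then the transported vertex exponent
`L a⋆ = (αm, (α + β − 1)m, i, j)` is a minimal exponent of `g`, and `2α + β ≥ 2`. [cite: CossartPiltant2019, Prop. 2.6]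
[cite: CossartJannsenSaito2020, Lemma 12.2] -/
theorem transport_vertex_mem_minExponents [IsLocalRing S] [IsLocalRing S₁] (φ : S →+* S₁) {x y z w : S}
    {x₁ z₁ w₁ : S₁} (ht : IsRsopPart ![x, y, z, w]) (ht' : IsRsopPart ![x₁, φ y, z₁, w₁])
    (hspan : Ideal.span {x, y, z, w} = maximalIdeal S) (hspan₁ : Ideal.span {x₁, φ y, z₁, w₁} = maximalIdeal S₁)
    (hx : φ x = φ y * x₁) (hz : φ z = φ y * z₁) (hw : φ w = φ y * w₁) {d : ℕ} {f : S} {g : S₁}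
    (hfd : f ∈ maximalIdeal S ^ d) (hg : g * φ y ^ d = φ f) (hgd : g ∈ maximalIdeal S₁ ^ d)
    {α β : ℚ} (hα : 0 ≤ α) (hβ : 0 ≤ β) (hG : BetaGe x y z w d α β f)
    {a : Fin 4 → ℕ} (ha : a ∈ minExponents ![x, y, z, w] f) (hzw : a 2 + a 3 < d)
    (ha0 : (a 0 : ℚ) = α * ((d - a 2 - a 3 : ℕ) : ℚ)) (ha1 : (a 1 : ℚ) = β * ((d - a 2 - a 3 : ℕ) : ℚ)) :
    (Function.update a 1 (∑ j ∈ (Finset.univ : Finset (Fin 4)), a j) - d • (Pi.single 1 1 : Fin 4 → ℕ)) ∈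
        minExponents ![x₁, φ y, z₁, w₁] g ∧ 2 ≤ 2 * α + β := by
  obtain ⟨h1, h2⟩ := minExponents_strictTransform φ ht ht' hspan hspan₁ hx hz hw hfd hg
  have hdegs := (mem_pow_iff_forall_minExponents ht hspan d f).mp hfd
  have hdegs' := (mem_pow_iff_forall_minExponents ht' hspan₁ d g).mp hgd
  have hGs := (betaGe_iff_forall_minExponents ht hα hβ f).mp hG
  obtain ⟨a', ha', hle⟩ := h2 a ha
  obtain ⟨a'', ha'', rfl⟩ := h1 a' ha'
  have hdeg : d ≤ a 0 + a 1 + a 2 + a 3 := by rw [← sum_four]; exact hdegs a ha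
  have htwo := two_mul_add_ge_two_of_vertex hzw ha0 ha1 hdeg hle (hdegs' _ ha')
  -- compare coordinates of `L a'' ≤ L a`
  obtain ⟨k0, k1, k2, k3⟩ := (le_transport_iff a _ d).mp hle
  obtain ⟨f0, f1, f2, f3⟩ := transport_apply a'' d
  rw [f0] at k0; rw [f1] at k1; rw [f2] at k2; rw [f3] at k3
  have hdeg'' : d ≤ a'' 0 + a'' 1 + a'' 2 + a'' 3 := by rw [← sum_four]; exact hdegs a'' ha''
  have hdegL := hdegs' _ ha'
  rw [sum_transport] at hdegL
  have heq : a'' = a :=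
    vertex_transport_arith hα hzw ha0 ha1 (hGs a'' ha'') k0 (by omega) k2 k3 (by omega)
  subst heq
  exact ⟨ha', htwo⟩

end Summit.ResolutionOfSingularities.ResolutionOfSingularities.Theorems.SwitchingDichotomy.BetaNewton

end
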